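import Summits.BirchSwinnertonDyer.BirchSwinnertonDyer.Theorems.SchneiderFreeAdditiveX3KYBranchThreeOfPrint
import Summits.BirchSwinnertonDyer.BirchSwinnertonDyer.Theorems.SchneiderFreeAdditiveX3KYLambdaAlgFiveLeOfCGLS
import HarnessLib

/-!
# Route `SchneiderFreeAdditiveX3` (K1 door): the `p = 3` NON-ANOMALOUS column, part 1 — the door inequality for every odd `p` under the
# non-anomalous clause and Keller–Yin Thm. 3.5.1 in branch currency at `p = 3` (NAT twist), RE-TYPED GREENBERG-FREE on CGLS 2022 Prop. 1.2.5
# (module AND corank clauses), Prop. 14, Cor. 1.2.6 ×2 and Milne ADT I Thm. 4.10 (a)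

Cell `bsd-schneider-ideate`, seat `bsd-schneider-door-c5` (prover, generation 40; assembly layer; `--supports` 19177).  PARTITION: board row
B6 ∩ X3 ∩ sst-twist, `r = 1`, (G-ord, `e = 2`) half at `p = 3`, non-anomalous twist (686 of 2 411 pairs; class-wide) of `Rank1Residual.partition` —
ASSEMBLY; types-the-object-of nothing new; RE-KEYS generation 25's `KYNonAnomalousTwist` §5–§6 and generation 26's `KYBranchThree` §1–§2 off Greenberg's
papers (the `p = 3` twin of F38a/F38b of this generation); closes none of B6's cells (BSD NOT advanced).  bears_on: K1-door (19177 r3).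
Proofs token-identical to generations 25/26 with `(h411 h263 h41 h42 h5A h32) ↦ (hge, hX)`: `hge : prop125_characterGrSelmerDual_corank_ge` (CGLS Prop.
1.2.5's corank clause, PUBLISHED, via F38a `charLambdaRelaxation_eq_of_ge`), `hX` = Milne ADT I Thm. 4.10 (a) at finite `S` over totally complex fields (via
cell `bsd-eis`'s `XAcImprimitiveNoPTorsion.xAc_smul_eq_zero_imp_ofPoitouTateAt`), Greenberg 2006 fed by tree theorems.
* §1 (namespace `KYLambdaAlgOfCGLS`, continuing F38a) `lambdaInvariant_xAc_empty_add_zpCorank_eq_of_nonAnomalous_ofPT`,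
  `lambdaInvariant_xAc_empty_add_zpCorank_eq_add_add_sum_of_nonAnomalous_ofCGLS`, `add_add_sum_le_…_of_nonAnomalous_ofCGLS` (generic, any odd `p`, `hna`
  displayed) and `add_add_sum_le_…_of_subGordTwo_of_forall_twist_ofCGLS` (the (G-ord, `e = 2`) cell with NAT(W, p)).
* §2 (namespace `KYBranchThreeOfCGLS`) `exists_firstUnitCoeffAt_le_lambdaInvariant_three` ([INV.λ≤] ∧ KYμ at a signed frame from [AN3] + [BR3]),
  `xac_charIdeal_map_eq_span_three_of_dvd` / `…_le_span_…` (Keller–Yin Thm. 3.5.1 in branch currency from [DIV.dvd] + [AN3] + [BR3]).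

INPUT LEDGER of the `p = 3` NAT column's algebraic side after this file: {CGLS 2022 Prop. 1.2.5 (module clause; corank clause), Prop. 14, Cor. 1.2.6 (i)(ii)}
∪ {Milne ADT I Thm. 4.10 (a) restricted, totally complex} — NO Greenberg input; analytic side unchanged ([AN3] PUB-composed, [BR3] PUB, [DIV.dvd] PRE).
HONEST FRAMING: compositions of tree theorems, CONDITIONAL BY NAME on the displayed statements; no definition, no named fact, no `sorry`; nothing analytic
touched; the anomalous `p = 3` branch is NOT touched here; BSD proved for no curve; «closes rung: none».  References: [CastellaGrossiLeeSkinner2022]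
Prop. 1.2.5, Cor. 1.2.6, Prop. 14, Thms. 1.2.2, 2.1.2, 2.2.2; [MilneADT2006] I Thm. 4.10 (a); [KellerYin2024b] §3.5, Thm. 3.5.1; [KellerYin2024] Thm. 1.4.1;
[GreenbergVatsal2000] §2; this seat p676261 (gen 25), p680016 (gen 26), p754591 (F38a).
-/

set_option autoImplicit false
set_option linter.dupNamespace false -- the summit namespace `…BirchSwinnertonDyer.BirchSwinnertonDyer.Theorems` (Sub = Summit, D-0017) trips it

noncomputable section

open scoped Classical Pointwise NumberField

open WeierstrassCurve NumberField IsDedekindDomain Field PowerSeries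
  Literature.NumberTheory.EllipticCurves Literature.NumberTheory.EllipticCurves.IwasawaAlgebra
  Literature.NumberTheory.EllipticCurves.GreenbergSelmer
  Literature.NumberTheory.EllipticCurves.GreenbergVatsal2000
  Literature.NumberTheory.GaloisRepresentations Literature.NumberTheory.GaloisCohomology IsDedekindDomain.HeightOneSpectrum
  Literature.NumberTheory.EllipticCurves.ModularForms
  Literature.NumberTheory.EllipticCurves.Rank1Residual Literature.NumberTheory.EllipticCurves.KellerYin2024
  Literature.NumberTheory.EllipticCurves.IwasawaDual Literature.NumberTheory.EllipticCurves.Castella2018.AcSelmer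
  Literature.NumberTheory.IwasawaTheory Literature.NumberTheory.IwasawaTheory.Greenberg2016
  Literature.NumberTheory.IwasawaTheory.Greenberg2006
  Summit.BirchSwinnertonDyer.Rank1Residual Summit.BirchSwinnertonDyer.Rank1Residual.Additive
  Summit.BirchSwinnertonDyer.Rank1Residual.X2.ResidualDevissageModules
  Summit.BirchSwinnertonDyer.BirchSwinnertonDyer.Theorems
  Summit.BirchSwinnertonDyer.BirchSwinnertonDyer.Theorems.SchneiderFree
  Summit.BirchSwinnertonDyer.BirchSwinnertonDyer.Theorems.SchneiderFreeAdditiveX3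
  Summit.BirchSwinnertonDyer.BirchSwinnertonDyer.Theorems.SchneiderFreeAdditiveX3.KYLambdaAlg
  Summit.BirchSwinnertonDyer.BirchSwinnertonDyer.Theorems.SchneiderFreeAdditiveX3.KYLambdaAlgChar
  Summit.BirchSwinnertonDyer.BirchSwinnertonDyer.Theorems.SchneiderFreeAdditiveX3.KYNonAnomalousTwist
  Summit.BirchSwinnertonDyer.BirchSwinnertonDyer.Theorems.SchneiderFreeAdditiveX3.KYBranchHalves
open Literature.NumberTheory.EllipticCurves.CastellaGrossiLeeSkinner2022
  (cor126_residualCharacter_globalLift cor126_residualCharacter_localSurjective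
    prop125_characterGrSelmerDual_torsion_muZero_dim prop125_characterGrSelmerDual_corank_ge prop14_residualCharacterSelmer_finite IsKatzLFunction)

namespace Summit.BirchSwinnertonDyer.BirchSwinnertonDyer.Theorems.SchneiderFreeAdditiveX3.KYLambdaAlgOfCGLS

variable {p : ℕ} [hp : Fact p.Prime]

/-! ### §1 The generic (non-anomalous-clause) λ-shift, identity and door inequality, any odd `p` — Greenberg-free -/

/-- **Generic (reduction-type-free) form of F38a §2's λ-shift, Greenberg-free:** at every Eisenstein Heegner datum with the non-anomalous clause `hna`,
`2 < p = v v̄`: `X_ac^∅(E_K)` f.g., `Λ`-torsion, `μ = 0`, and `λ(X_ac^∅(E_K)) + corank_{ℤ_p}(Sel_{v̄}^{Sf}/Sel_{v̄}^∅) = λ(Dsub.X) + λ(Dquot.X)` for every residual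
pair and all strict dual data at `Sf`, modulo CGLS Prop. 1.2.5 (module clause), Prop. 14, Cor. 1.2.6 ×2 and Milne ADT I Thm. 4.10 (a) — generation 25's
`KYNonAnomalousTwist.…_of_nonAnomalous_of_facts` with `h411 ↦ hX` (F38a `lambdaInvariant_xAc_eq_add_of_nonAnomalous_ofPT`).
[cite: KellerYin2024, Thm. 1.4.1 and proof of Thm. 1.5.1 (arXiv:2402.12781v2)] [cite: CastellaGrossiLeeSkinner2022, §1.2 Prop. 1.2.5, Prop. 14, Cor. 1.2.6, §1.4]
[cite: GreenbergVatsal2000, §2 Cor. (2.3)] [cite: MilneADT2006, I Thm. 4.10 (a)] -/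
theorem lambdaInvariant_xAc_empty_add_zpCorank_eq_of_nonAnomalous_ofPT
    (hprop125 : prop125_characterGrSelmerDual_torsion_muZero_dim) (hfact : prop14_residualCharacterSelmer_finite)
    (hlift : cor126_residualCharacter_globalLift) (hlocal : cor126_residualCharacter_localSurjective)
    (hPT : ∀ (L : Type) [Field L] [NumberField L] [IsTotallyComplex L] (S : Set (HeightOneSpectrum (𝓞 L))),
      S.Finite → Literature.NumberTheory.GaloisCohomology.poitouTate_shaRestricted_tateDual_natural_at L S)
    (W : WeierstrassCurve ℚ) [W.IsElliptic] [W.IsGloballyMinimal]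
    (K : Type) [Field K] [NumberField K] {v : HeightOneSpectrum (𝓞 K)} (vbar : HeightOneSpectrum (𝓞 K))
    (κ : ZpExtension K p) (γ : absoluteGaloisGroup K) [Fact (κ.IsTopGenerator γ)]
    (Sf : Finset (HeightOneSpectrum (𝓞 K)))
    (hp2 : 2 < p) (hred : Red W p)
    (hK : IsImaginaryQuadratic K) (hH : SatisfiesHeegnerHypothesis (W.conductorNorm ℤ) K)
    (hsplit : ((Ideal.span {(p : ℤ)}).primesOver (𝓞 K)).ncard = 2)
    (hv : ((p : ℕ) : 𝓞 K) ∈ v.asIdeal) (hvbar : ((p : ℕ) : 𝓞 K) ∈ vbar.asIdeal) (hne : vbar ≠ v) (hκ : κ.IsAnticyclotomic)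
    (hSf : ∀ w : HeightOneSpectrum (𝓞 K), w ∈ Sf ↔
      (((W.conductorNorm ℤ : ℤ) : 𝓞 K) ∈ w.asIdeal ∧ ((p : ℕ) : 𝓞 K) ∉ w.asIdeal))
    (hna : ∀ (v : HeightOneSpectrum (𝓞 ℚ)), ((p : ℕ) : 𝓞 ℚ) ∈ v.asIdeal →
      ∀ (Φ : AddSubgroup (geomTorsion W (p : ℤ))), Nat.card Φ = p →
      ∀ 𝔓 ∈ v.primesAbove,
        (¬ ∀ g ∈ 𝔓.decompositionSubgroup (absoluteGaloisGroup ℚ), ∀ P ∈ Φ, g • P = P) ∧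
          (¬ ∀ g ∈ 𝔓.decompositionSubgroup (absoluteGaloisGroup ℚ),
            ∀ P : geomTorsion W (p : ℤ), g • P - P ∈ Φ))
    (θsub θquot : FramedGaloisRep K (padicCoeffIntegers (∅ : Set (PadicAlgCl p))) 1)
    (hpair : IsResidualPairOver (W.baseChange K) p θsub θquot)
    (Dsub : GrDualData κ (charModule (∅ : Set (PadicAlgCl p)) θsub) vbar (↑Sf : Set (HeightOneSpectrum (𝓞 K))) γ)
    (Dquot : GrDualData κ (charModule (∅ : Set (PadicAlgCl p)) θquot) vbar (↑Sf : Set (HeightOneSpectrum (𝓞 K))) γ) :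
    Module.Finite (IwasawaAlgebra p) (XAc (W.baseChange K) p κ vbar (∅ : Set (HeightOneSpectrum (𝓞 K))) γ) ∧
      Module.IsTorsion (IwasawaAlgebra p) (XAc (W.baseChange K) p κ vbar (∅ : Set (HeightOneSpectrum (𝓞 K))) γ) ∧
      muInvariant p (XAc (W.baseChange K) p κ vbar (∅ : Set (HeightOneSpectrum (𝓞 K))) γ) = 0 ∧
      lambdaInvariant p (XAc (W.baseChange K) p κ vbar (∅ : Set (HeightOneSpectrum (𝓞 K))) γ) +
          zpCorank (↥(selmerAc (W.baseChange K) p κ vbar (↑Sf : Set (HeightOneSpectrum (𝓞 K)))) ⧸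
            (selmerAc (W.baseChange K) p κ vbar (∅ : Set (HeightOneSpectrum (𝓞 K)))).addSubgroupOf
              (selmerAc (W.baseChange K) p κ vbar (↑Sf : Set (HeightOneSpectrum (𝓞 K))))) p =
        lambdaInvariant p Dsub.X + lambdaInvariant p Dquot.X := by
  haveI hEK : (W.baseChange K).IsElliptic := inferInstanceAs (W.map (algebraMap ℚ K)).IsElliptic
  obtain ⟨hXfin, hXtor, hμ⟩ := xAc_moduleFinite_isTorsion_muInvariant_of_prop14_of_nonAnomalous hfact W K vbar κ γ Sf hp2 hred hK
    hH hsplit hvbar hκ hSf hna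
  haveI := hXfin
  obtain ⟨hfin₀, htor₀, hμ₀, -, hshift⟩ :=
    XAcImprimitiveLambdaShift.lambdaInvariant_eq_add_zpCorank_of_muInvariant_eq_zero (W.baseChange K) p κ vbar γ
      (Set.empty_subset (↑Sf : Set (HeightOneSpectrum (𝓞 K)))) hXtor hμ
  have heq := lambdaInvariant_xAc_eq_add_of_nonAnomalous_ofPT hprop125 hfact hlift hlocal hPT W K vbar κ γ Sf
    hp2 hred hK hH hsplit hv hvbar hne hκ hSf hna θsub θquot hpair Dsub Dquot
  exact ⟨hfin₀, htor₀, hμ₀, by rw [← heq, hshift]⟩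

/-- **Generic form of F38a §3's identity, Greenberg-free:** at every Eisenstein Heegner datum with the non-anomalous clause, `2 < p = v v̄`:
`λ(X_ac^∅(E_K)) + corank_{ℤ_p}(Sel_{v̄}^{Sf}/Sel_{v̄}^∅) = λ(𝔛_{θsub}) + λ(𝔛_{θquot}) + Σ_{w∈Sf}(λ𝒫_w(θsub) + λ𝒫_w(θquot))` for every residual pair and ALL primitive
strict dual data, modulo CGLS Prop. 1.2.5 (module + corank clauses), Prop. 14, Cor. 1.2.6 ×2 and Milne I 4.10 (a).
[cite: KellerYin2024, Prop. 1.2.5, Thm. 1.4.1, proof of Thm. 1.5.1 (arXiv:2402.12781v2)] [cite: CastellaGrossiLeeSkinner2022, §1.2 Prop. 1.2.5, Cor. 1.2.6, Prop. 14, §1.4]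
[cite: GreenbergVatsal2000, §2 Cor. (2.3), Prop. (2.4)] [cite: MilneADT2006, I Thm. 4.10 (a)] -/
theorem lambdaInvariant_xAc_empty_add_zpCorank_eq_add_add_sum_of_nonAnomalous_ofCGLS
    (hprop125 : prop125_characterGrSelmerDual_torsion_muZero_dim) (hge : prop125_characterGrSelmerDual_corank_ge) (hfact : prop14_residualCharacterSelmer_finite)
    (hlift : cor126_residualCharacter_globalLift) (hlocal : cor126_residualCharacter_localSurjective)
    (hPT : ∀ (L : Type) [Field L] [NumberField L] [IsTotallyComplex L] (S : Set (HeightOneSpectrum (𝓞 L))),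
      S.Finite → Literature.NumberTheory.GaloisCohomology.poitouTate_shaRestricted_tateDual_natural_at L S)
    (W : WeierstrassCurve ℚ) [W.IsElliptic] [W.IsGloballyMinimal]
    (K : Type) [Field K] [NumberField K] {v : HeightOneSpectrum (𝓞 K)} (vbar : HeightOneSpectrum (𝓞 K))
    (κ : ZpExtension K p) (γ : absoluteGaloisGroup K) [hγ : Fact (κ.IsTopGenerator γ)]
    (Sf : Finset (HeightOneSpectrum (𝓞 K)))
    (hp2 : 2 < p) (hred : Red W p)
    (hK : IsImaginaryQuadratic K) (hH : SatisfiesHeegnerHypothesis (W.conductorNorm ℤ) K)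
    (hsplit : ((Ideal.span {(p : ℤ)}).primesOver (𝓞 K)).ncard = 2)
    (hv : ((p : ℕ) : 𝓞 K) ∈ v.asIdeal) (hvbar : ((p : ℕ) : 𝓞 K) ∈ vbar.asIdeal) (hne : vbar ≠ v) (hκ : κ.IsAnticyclotomic)
    (hSf : ∀ w : HeightOneSpectrum (𝓞 K), w ∈ Sf ↔
      (((W.conductorNorm ℤ : ℤ) : 𝓞 K) ∈ w.asIdeal ∧ ((p : ℕ) : 𝓞 K) ∉ w.asIdeal))
    (hna : ∀ (v : HeightOneSpectrum (𝓞 ℚ)), ((p : ℕ) : 𝓞 ℚ) ∈ v.asIdeal →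
      ∀ (Φ : AddSubgroup (geomTorsion W (p : ℤ))), Nat.card Φ = p →
      ∀ 𝔓 ∈ v.primesAbove,
        (¬ ∀ g ∈ 𝔓.decompositionSubgroup (absoluteGaloisGroup ℚ), ∀ P ∈ Φ, g • P = P) ∧
          (¬ ∀ g ∈ 𝔓.decompositionSubgroup (absoluteGaloisGroup ℚ),
            ∀ P : geomTorsion W (p : ℤ), g • P - P ∈ Φ))
    (θsub θquot : FramedGaloisRep K (padicCoeffIntegers (∅ : Set (PadicAlgCl p))) 1)
    (hpair : IsResidualPairOver (W.baseChange K) p θsub θquot)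
    (D0sub : GrDualData κ (charModule (∅ : Set (PadicAlgCl p)) θsub) vbar (∅ : Set (HeightOneSpectrum (𝓞 K))) γ)
    (D0quot : GrDualData κ (charModule (∅ : Set (PadicAlgCl p)) θquot) vbar (∅ : Set (HeightOneSpectrum (𝓞 K))) γ) :
    lambdaInvariant p (XAc (W.baseChange K) p κ vbar (∅ : Set (HeightOneSpectrum (𝓞 K))) γ) +
        zpCorank (↥(selmerAc (W.baseChange K) p κ vbar (↑Sf : Set (HeightOneSpectrum (𝓞 K)))) ⧸
          (selmerAc (W.baseChange K) p κ vbar (∅ : Set (HeightOneSpectrum (𝓞 K)))).addSubgroupOf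
            (selmerAc (W.baseChange K) p κ vbar (↑Sf : Set (HeightOneSpectrum (𝓞 K))))) p =
      lambdaInvariant p D0sub.X + lambdaInvariant p D0quot.X +
        ∑ w ∈ Sf, (charLocalLambda (∅ : Set (PadicAlgCl p)) κ θsub w + charLocalLambda (∅ : Set (PadicAlgCl p)) κ θquot w) := by
  obtain ⟨Dsub⟩ := nonempty_grDualData_char (∅ : Set (PadicAlgCl p)) θsub κ vbar (↑Sf : Set (HeightOneSpectrum (𝓞 K))) hγ.out
  obtain ⟨Dquot⟩ := nonempty_grDualData_char (∅ : Set (PadicAlgCl p)) θquot κ vbar (↑Sf : Set (HeightOneSpectrum (𝓞 K))) hγ.out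
  obtain ⟨-, -, -, hshift⟩ := lambdaInvariant_xAc_empty_add_zpCorank_eq_of_nonAnomalous_ofPT hprop125 hfact hlift hlocal hPT W K vbar κ γ Sf hp2 hred hK hH hsplit hv hvbar hne hκ hSf hna θsub θquot hpair Dsub Dquot
  have himp := lambdaInvariant_xAc_eq_add_of_nonAnomalous_ofPT hprop125 hfact hlift hlocal hPT W K vbar κ γ Sf
    hp2 hred hK hH hsplit hv hvbar hne hκ hSf hna θsub θquot hpair Dsub Dquot
  have hchar := lambdaInvariant_xAc_eq_add_add_sum_of_nonAnomalous_ofCGLS hprop125 hge hfact hlift hlocal hPT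
    W K vbar κ γ Sf hp2 hred hK hH hsplit hv hvbar hne hκ hSf hna θsub θquot hpair D0sub D0quot
  rw [hshift, ← himp, hchar]

/-- **Generic form of THE DOOR INEQUALITY, Greenberg-free:** at every Eisenstein Heegner datum with the non-anomalous clause, `2 < p = v v̄`:
`λ(𝔛_{θsub}) + λ(𝔛_{θquot}) + Σ_{w∈Sf}(λ𝒫_w(θsub) + λ𝒫_w(θquot)) ≤ λ(X_ac^∅(E_K)) + Σ_{w∈Sf} λ𝒫_w(E_K)` for every residual pair and ALL primitive strict
dual data, modulo CGLS ×5 and Milne I 4.10 (a) — the identity above plus cell `bsd-eis`'s UNCONDITIONAL `corank ≤ Σ λ𝒫_w(E_K)`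
(`FSideCorankLeOffP.zpCorank_selmerAc_quotient_le_sum_curveLocalLambda_of_offP_iff`).
[cite: GreenbergVatsal2000, §2 Cor. (2.3), Prop. (2.4)] [cite: KellerYin2024, Prop. 1.2.5, Thm. 1.4.1, §1.5 (arXiv:2402.12781v2)]
[cite: CastellaGrossiLeeSkinner2022, §1.2 Prop. 1.2.5, Cor. 1.2.6, Prop. 14, §1.4] [cite: MilneADT2006, I Thm. 4.10 (a)] -/
theorem add_add_sum_le_lambdaInvariant_xAc_empty_add_sum_curveLocalLambda_of_nonAnomalous_ofCGLS
    (hprop125 : prop125_characterGrSelmerDual_torsion_muZero_dim) (hge : prop125_characterGrSelmerDual_corank_ge) (hfact : prop14_residualCharacterSelmer_finite)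
    (hlift : cor126_residualCharacter_globalLift) (hlocal : cor126_residualCharacter_localSurjective)
    (hPT : ∀ (L : Type) [Field L] [NumberField L] [IsTotallyComplex L] (S : Set (HeightOneSpectrum (𝓞 L))),
      S.Finite → Literature.NumberTheory.GaloisCohomology.poitouTate_shaRestricted_tateDual_natural_at L S)
    (W : WeierstrassCurve ℚ) [W.IsElliptic] [W.IsGloballyMinimal]
    (K : Type) [Field K] [NumberField K] {v : HeightOneSpectrum (𝓞 K)} (vbar : HeightOneSpectrum (𝓞 K))
    (κ : ZpExtension K p) (γ : absoluteGaloisGroup K) [hγ : Fact (κ.IsTopGenerator γ)]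
    (Sf : Finset (HeightOneSpectrum (𝓞 K)))
    (hp2 : 2 < p) (hred : Red W p)
    (hK : IsImaginaryQuadratic K) (hH : SatisfiesHeegnerHypothesis (W.conductorNorm ℤ) K)
    (hsplit : ((Ideal.span {(p : ℤ)}).primesOver (𝓞 K)).ncard = 2)
    (hv : ((p : ℕ) : 𝓞 K) ∈ v.asIdeal) (hvbar : ((p : ℕ) : 𝓞 K) ∈ vbar.asIdeal) (hne : vbar ≠ v) (hκ : κ.IsAnticyclotomic)
    (hSf : ∀ w : HeightOneSpectrum (𝓞 K), w ∈ Sf ↔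
      (((W.conductorNorm ℤ : ℤ) : 𝓞 K) ∈ w.asIdeal ∧ ((p : ℕ) : 𝓞 K) ∉ w.asIdeal))
    (hna : ∀ (v : HeightOneSpectrum (𝓞 ℚ)), ((p : ℕ) : 𝓞 ℚ) ∈ v.asIdeal →
      ∀ (Φ : AddSubgroup (geomTorsion W (p : ℤ))), Nat.card Φ = p →
      ∀ 𝔓 ∈ v.primesAbove,
        (¬ ∀ g ∈ 𝔓.decompositionSubgroup (absoluteGaloisGroup ℚ), ∀ P ∈ Φ, g • P = P) ∧
          (¬ ∀ g ∈ 𝔓.decompositionSubgroup (absoluteGaloisGroup ℚ),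
            ∀ P : geomTorsion W (p : ℤ), g • P - P ∈ Φ))
    (θsub θquot : FramedGaloisRep K (padicCoeffIntegers (∅ : Set (PadicAlgCl p))) 1)
    (hpair : IsResidualPairOver (W.baseChange K) p θsub θquot)
    (D0sub : GrDualData κ (charModule (∅ : Set (PadicAlgCl p)) θsub) vbar (∅ : Set (HeightOneSpectrum (𝓞 K))) γ)
    (D0quot : GrDualData κ (charModule (∅ : Set (PadicAlgCl p)) θquot) vbar (∅ : Set (HeightOneSpectrum (𝓞 K))) γ) :
    lambdaInvariant p D0sub.X + lambdaInvariant p D0quot.X +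
        ∑ w ∈ Sf, (charLocalLambda (∅ : Set (PadicAlgCl p)) κ θsub w + charLocalLambda (∅ : Set (PadicAlgCl p)) κ θquot w) ≤
      lambdaInvariant p (XAc (W.baseChange K) p κ vbar (∅ : Set (HeightOneSpectrum (𝓞 K))) γ) +
        ∑ w ∈ Sf, curveLocalLambda κ (W.baseChange K) w := by
  have heq := lambdaInvariant_xAc_empty_add_zpCorank_eq_add_add_sum_of_nonAnomalous_ofCGLS hprop125 hge hfact hlift hlocal hPT W K vbar κ γ Sf hp2 hred hK hH hsplit hv hvbar hne hκ hSf hna θsub θquot hpair D0sub D0quot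
  have hle := FSideCorankLeOffP.zpCorank_selmerAc_quotient_le_sum_curveLocalLambda_of_offP_iff W hp2 hK hH κ hκ hγ.out
    vbar Sf hSf
  rw [← heq]
  exact Nat.add_le_add_left hle _

/-- **THE DOOR INEQUALITY ON THE (G-ord, `e = 2`) CELL WITH `NAT(W, p)`, every odd `p` — in particular `p = 3` for the non-anomalous pairs — Greenberg-free**
(modulo CGLS Prop. 1.2.5 module + corank clauses, Prop. 14, Cor. 1.2.6 ×2 and Milne ADT I Thm. 4.10 (a)): generation 25's cell form re-typed.
[cite: KellerYin2024b, Thm. 3.5.1 first sentence "λ(𝔛) = λ(𝓛_ε)" (arXiv:2410.23241 p. 20) (preprint; algebraic side derived for odd p under NAT)]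
[cite: CastellaGrossiLeeSkinner2022, §1.2 Prop. 1.2.5, Cor. 1.2.6, Prop. 14, §1.4] [cite: MilneADT2006, I Thm. 4.10 (a)] -/
theorem add_add_sum_le_lambdaInvariant_xAc_empty_add_sum_curveLocalLambda_of_subGordTwo_of_forall_twist_ofCGLS
    (hprop125 : prop125_characterGrSelmerDual_torsion_muZero_dim) (hge : prop125_characterGrSelmerDual_corank_ge) (hfact : prop14_residualCharacterSelmer_finite)
    (hlift : cor126_residualCharacter_globalLift) (hlocal : cor126_residualCharacter_localSurjective)
    (hPT : ∀ (L : Type) [Field L] [NumberField L] [IsTotallyComplex L] (S : Set (HeightOneSpectrum (𝓞 L))),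
      S.Finite → Literature.NumberTheory.GaloisCohomology.poitouTate_shaRestricted_tateDual_natural_at L S)
    (W : WeierstrassCurve ℚ) [W.IsElliptic] [W.IsGloballyMinimal]
    (K : Type) [Field K] [NumberField K] {v : HeightOneSpectrum (𝓞 K)} (vbar : HeightOneSpectrum (𝓞 K))
    (κ : ZpExtension K p) (γ : absoluteGaloisGroup K) [hγ : Fact (κ.IsTopGenerator γ)]
    (Sf : Finset (HeightOneSpectrum (𝓞 K)))
    (hp2 : 2 < p) (hX : ClassX3 W p) (hSG : SubGordTwo W p)
    (htw : ∀ (V : WeierstrassCurve ℚ) [V.IsElliptic] [V.IsGloballyMinimal] (C : VariableChange ℚ),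
      GoodOrd V p → C • V.quadraticTwist ((-1 : ℚ) ^ (p / 2) * p) = W → ¬ (p : ℤ) ∣ V.frobeniusTrace p - 1)
    (hK : IsImaginaryQuadratic K) (hH : SatisfiesHeegnerHypothesis (W.conductorNorm ℤ) K)
    (hsplit : ((Ideal.span {(p : ℤ)}).primesOver (𝓞 K)).ncard = 2)
    (hv : ((p : ℕ) : 𝓞 K) ∈ v.asIdeal) (hvbar : ((p : ℕ) : 𝓞 K) ∈ vbar.asIdeal) (hne : vbar ≠ v) (hκ : κ.IsAnticyclotomic)
    (hSf : ∀ w : HeightOneSpectrum (𝓞 K), w ∈ Sf ↔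
      (((W.conductorNorm ℤ : ℤ) : 𝓞 K) ∈ w.asIdeal ∧ ((p : ℕ) : 𝓞 K) ∉ w.asIdeal))
    (θsub θquot : FramedGaloisRep K (padicCoeffIntegers (∅ : Set (PadicAlgCl p))) 1)
    (hpair : IsResidualPairOver (W.baseChange K) p θsub θquot)
    (D0sub : GrDualData κ (charModule (∅ : Set (PadicAlgCl p)) θsub) vbar (∅ : Set (HeightOneSpectrum (𝓞 K))) γ)
    (D0quot : GrDualData κ (charModule (∅ : Set (PadicAlgCl p)) θquot) vbar (∅ : Set (HeightOneSpectrum (𝓞 K))) γ) :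
    lambdaInvariant p D0sub.X + lambdaInvariant p D0quot.X +
        ∑ w ∈ Sf, (charLocalLambda (∅ : Set (PadicAlgCl p)) κ θsub w + charLocalLambda (∅ : Set (PadicAlgCl p)) κ θquot w) ≤
      lambdaInvariant p (XAc (W.baseChange K) p κ vbar (∅ : Set (HeightOneSpectrum (𝓞 K))) γ) +
        ∑ w ∈ Sf, curveLocalLambda κ (W.baseChange K) w :=
  add_add_sum_le_lambdaInvariant_xAc_empty_add_sum_curveLocalLambda_of_nonAnomalous_ofCGLS hprop125 hge hfact hlift hlocal hPT W K vbar κ γ Sf hp2 hX.1 hK hH hsplit hv hvbar hne hκ hSf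
    (hna_card_of_subGordTwo_of_forall_twist W hp2 hX hSG htw) θsub θquot hpair D0sub D0quot

end Summit.BirchSwinnertonDyer.BirchSwinnertonDyer.Theorems.SchneiderFreeAdditiveX3.KYLambdaAlgOfCGLS

namespace Summit.BirchSwinnertonDyer.BirchSwinnertonDyer.Theorems.SchneiderFreeAdditiveX3.KYBranchThreeOfCGLS

open Summit.BirchSwinnertonDyer.BirchSwinnertonDyer.Theorems.SchneiderFreeAdditiveX3.KYLambdaAlgOfCGLS

/-! ### §2 Keller–Yin Thm. 3.5.1 in branch currency at `p = 3`, non-anomalous twist — Greenberg-free -/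

section Three

/-- **[INV.λ≤] ∧ KYμ at `p = 3`, non-anomalous twist, at a SIGNED Castella–Hsieh frame, Greenberg-free** — generation 26's
`KYBranchThree.exists_firstUnitCoeffAt_le_lambdaInvariant_three` with the door inequality taken from the CGLS/Milne-typed cell form above: from [AN3]
`n + Σ λ𝒫_w(W_K) = 2nφ + ΣΣ`, [BR3] `λ(𝔛_{θsub}) = λ(𝔛_{θquot}) = nφ` and that inequality, `∃ n, FirstUnitCoeffAt L n ∧ n ≤ λ(X_ac^∅(W_K))`.
[claim: KellerYin2024PotOrd, status: under-review] [cite: KellerYin2024b, §3.5 and Thm. 3.5.1 (arXiv:2410.23241 p. 20) (the λ-comparison, preprint; hypotheses)]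
[cite: CastellaGrossiLeeSkinner2022, Thms. 1.2.2, 2.2.2, 2.2.4 and Props. 1.2.5, 14] [cite: MilneADT2006, I Thm. 4.10 (a)] -/
theorem exists_firstUnitCoeffAt_le_lambdaInvariant_three
    (hAN : thm351_anacong_branch_three) (hBR : thm122_charLambda_pair_three)
    (hprop125 : prop125_characterGrSelmerDual_torsion_muZero_dim) (hge : prop125_characterGrSelmerDual_corank_ge) (hfact : prop14_residualCharacterSelmer_finite)
    (hlift : cor126_residualCharacter_globalLift) (hlocal : cor126_residualCharacter_localSurjective)
    (hPT : ∀ (L : Type) [Field L] [NumberField L] [IsTotallyComplex L] (S : Set (HeightOneSpectrum (𝓞 L))),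
      S.Finite → Literature.NumberTheory.GaloisCohomology.poitouTate_shaRestricted_tateDual_natural_at L S)
    (ι' : PadicAlgCl 3 ≃+* ℂ) (W : WeierstrassCurve ℚ) [W.IsElliptic] [W.IsGloballyMinimal]
    (K : Type) [Field K] [NumberField K] [IsGalois ℚ K]
    (v vbar : HeightOneSpectrum (𝓞 K)) (κ : ZpExtension K 3) (γ : absoluteGaloisGroup K)
    [hγ : Fact (κ.IsTopGenerator γ)] {N : ℕ} [NeZero N] {f : CuspForm (CongruenceSubgroup.Gamma0 N) 2}
    (hf : IsNewformOf W f) (hS : PotOrdSetting ι' W K v vbar κ N)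
    (hX : ClassX3 W 3) (hSG : SubGordTwo W 3)
    (hna : ∀ (V : WeierstrassCurve ℚ) [V.IsElliptic] [V.IsGloballyMinimal] (C : VariableChange ℚ),
      GoodOrd V 3 → C • V.quadraticTwist ((-1 : ℚ) ^ (3 / 2) * (3 : ℕ)) = W → ¬ (3 : ℤ) ∣ V.frobeniusTrace 3 - 1)
    (hv3 : ((3 : ℕ) : 𝓞 K) ∈ v.asIdeal)
    {N' : ℕ} [NeZero N'] {f' : CuspForm (CongruenceSubgroup.Gamma0 N') 2} (hf' : IsNewform0 f') (hN' : ¬ 3 ∣ N')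
    (htw : ∃ S : Finset ℕ, ∀ ℓ : ℕ, ℓ.Prime → ℓ ∉ S →
      cuspCoeff f ℓ = ((legendreSym 3 ℓ : ℤ) : ℂ) * cuspCoeff f' ℓ)
    {θsub θquot : FramedGaloisRep K (padicCoeffIntegers (∅ : Set (PadicAlgCl 3))) 1}
    (hpair : IsResidualPairOver (W.baseChange K) 3 θsub θquot)
    {θ₀ : FramedGaloisRep K (padicCoeffIntegers (∅ : Set (PadicAlgCl 3))) 1} (hθ₀ : θ₀ = θsub ∨ θ₀ = θquot)
    {θ₀K : HeckeCharacter K} (hθ₀K : IsHeckeCharOf ι' θ₀ θ₀K) (hv0 : θ₀K.IsUnramifiedAt v) (hvbar0 : θ₀K.IsUnramifiedAt vbar)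
    {Cbar : Finset (HeightOneSpectrum (𝓞 K))} (hCbar : ∀ u ∈ Cbar, ¬ θ₀K.IsUnramifiedAt u)
    {ΩK' : ℂ} {Ωp' : (unrIntegers 3)ˣ} {Lφ : UnrSeries 3} (hΩK' : ΩK' ≠ 0)
    (hLφ : IsKatzLFunction ι' v vbar Cbar κ γ θ₀K ΩK' ((Ωp' : unrIntegers 3) : ℂ_[3]) Lφ)
    {e : ℂ} {ΩK : ℂ} {Ωp : (unrIntegers 3)ˣ} {L : UnrSeries 3} (he : e = 1 ∨ e = -1) (hΩK : ΩK ≠ 0)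
    (hL : IsBranchBDPLFunction ι' v κ γ f' (KellerYin2024.genusHeckeCharacter K 3) e ΩK ((Ωp : unrIntegers 3) : ℂ_[3]) L) :
    ∃ n : ℕ, FirstUnitCoeffAt L n ∧
      n ≤ lambdaInvariant 3 (XAc (W.baseChange K) 3 κ vbar (∅ : Set (HeightOneSpectrum (𝓞 K))) γ) := by
  obtain ⟨Sf, hSf⟩ := KYBranchThree.exists_finset_primes_over_not_three (K := K) N
  have hSf' : ∀ w : HeightOneSpectrum (𝓞 K), w ∈ Sf ↔
      (((W.conductorNorm ℤ : ℤ) : 𝓞 K) ∈ w.asIdeal ∧ ((3 : ℕ) : 𝓞 K) ∉ w.asIdeal) := by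
    rw [hS.level]; exact hSf
  -- [AN3] and [BR3]
  obtain ⟨n, nφ, hLn, hLφn, hcount⟩ := hAN ι' W K v vbar κ γ hf hS hna hf' hN' htw θsub θquot hpair Sf hSf θ₀ hθ₀ θ₀K
    hθ₀K hv0 hvbar0 Cbar hCbar ΩK' Ωp' Lφ hΩK' hLφ e ΩK Ωp L he hΩK hL
  obtain ⟨nφ', hLφn', hchar⟩ := hBR ι' W K v vbar κ γ hf hS hna θsub θquot hpair θ₀ hθ₀ θ₀K hθ₀K hv0 hvbar0 Cbar hCbar
    ΩK' Ωp' Lφ hΩK' hLφ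
  obtain rfl : nφ = nφ' := hLφn.unique hLφn'
  obtain ⟨Dsub⟩ := nonempty_grDualData_char (∅ : Set (PadicAlgCl 3)) (θ := θsub) (κ := κ) (vbar := vbar)
    (S₀ := (∅ : Set (HeightOneSpectrum (𝓞 K)))) hγ.out
  obtain ⟨Dquot⟩ := nonempty_grDualData_char (∅ : Set (PadicAlgCl 3)) (θ := θquot) (κ := κ) (vbar := vbar)
    (S₀ := (∅ : Set (HeightOneSpectrum (𝓞 K)))) hγ.out
  have hsub : lambdaInvariant 3 Dsub.X = nφ := hchar θsub (Or.inl rfl) Dsub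
  have hquot : lambdaInvariant 3 Dquot.X = nφ := hchar θquot (Or.inr rfl) Dquot
  -- the published-fact door inequality (generation 25)
  have hineq := add_add_sum_le_lambdaInvariant_xAc_empty_add_sum_curveLocalLambda_of_subGordTwo_of_forall_twist_ofCGLS
    hprop125 hge hfact hlift hlocal hPT W K vbar κ γ Sf (by norm_num) hX hSG hna hS.imagQuad
    (by rw [hS.level]; exact hS.heegner) hS.split hv3 hS.mem_vbar hS.vbar_ne hS.anticyclotomic hSf' θsub θquot hpair Dsub Dquot
  rw [hsub, hquot] at hineq
  refine ⟨n, hLn, ?_⟩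
  omega

/-- **Keller–Yin Thm. 3.5.1 (branch currency) at `p = 3` for a non-anomalous twist, at a signed frame, along any structure map `j`, Greenberg-free:**
`Ch_Λ(X_ac^∅(W_K))·R₀⟦T⟧ = (L)` and the first unit coefficient of `L` sits EXACTLY at `λ(𝔛)` — from [DIV.dvd] (PREPRINT), [AN3], [BR3], CGLS ×5 and
Milne I 4.10 (a); generation 26's theorem with §1 in place of its Greenberg-fed λ-inequality. [claim: KellerYin2024PotOrd, status: under-review]
[cite: KellerYin2024b, Thm. 3.3.6, Prop. 3.4.4, §3.5 and Thm. 3.5.1 (arXiv:2410.23241 pp. 19–20) (preprint; hypotheses and the sentence derived)]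
[cite: CastellaGrossiLeeSkinner2022, Thm. 3.2.1, Thms. 1.2.2, 2.2.2, Prop. 14] [cite: MilneADT2006, I Thm. 4.10 (a)] [cite: Washington1997, §7.1 Prop. 7.2 and §13.2] -/
theorem xac_charIdeal_map_eq_span_three_of_dvd
    (hAN : thm351_anacong_branch_three) (hBR : thm122_charLambda_pair_three)
    (hprop125 : prop125_characterGrSelmerDual_torsion_muZero_dim) (hge : prop125_characterGrSelmerDual_corank_ge) (hfact : prop14_residualCharacterSelmer_finite)
    (hlift : cor126_residualCharacter_globalLift) (hlocal : cor126_residualCharacter_localSurjective)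
    (hPT : ∀ (L : Type) [Field L] [NumberField L] [IsTotallyComplex L] (S : Set (HeightOneSpectrum (𝓞 L))),
      S.Finite → Literature.NumberTheory.GaloisCohomology.poitouTate_shaRestricted_tateDual_natural_at L S)
    (hDVD : thm336_dvd_branch_OPEN)
    (ι' : PadicAlgCl 3 ≃+* ℂ) (W : WeierstrassCurve ℚ) [W.IsElliptic] [W.IsGloballyMinimal]
    (K : Type) [Field K] [NumberField K] [IsGalois ℚ K]
    (v vbar : HeightOneSpectrum (𝓞 K)) (κ : ZpExtension K 3) (γ : absoluteGaloisGroup K)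
    [hγ : Fact (κ.IsTopGenerator γ)] {N : ℕ} [NeZero N] {f : CuspForm (CongruenceSubgroup.Gamma0 N) 2}
    (hf : IsNewformOf W f) (hS : PotOrdSetting ι' W K v vbar κ N)
    (hX : ClassX3 W 3) (hSG : SubGordTwo W 3)
    (hna : ∀ (V : WeierstrassCurve ℚ) [V.IsElliptic] [V.IsGloballyMinimal] (C : VariableChange ℚ),
      GoodOrd V 3 → C • V.quadraticTwist ((-1 : ℚ) ^ (3 / 2) * (3 : ℕ)) = W → ¬ (3 : ℤ) ∣ V.frobeniusTrace 3 - 1)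
    (hv3 : ((3 : ℕ) : 𝓞 K) ∈ v.asIdeal)
    {N' : ℕ} [NeZero N'] {f' : CuspForm (CongruenceSubgroup.Gamma0 N') 2} (hf' : IsNewform0 f') (hN' : ¬ 3 ∣ N')
    (htw : ∃ S : Finset ℕ, ∀ ℓ : ℕ, ℓ.Prime → ℓ ∉ S →
      cuspCoeff f ℓ = ((legendreSym 3 ℓ : ℤ) : ℂ) * cuspCoeff f' ℓ)
    {θsub θquot : FramedGaloisRep K (padicCoeffIntegers (∅ : Set (PadicAlgCl 3))) 1}
    (hpair : IsResidualPairOver (W.baseChange K) 3 θsub θquot)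
    {θ₀ : FramedGaloisRep K (padicCoeffIntegers (∅ : Set (PadicAlgCl 3))) 1} (hθ₀ : θ₀ = θsub ∨ θ₀ = θquot)
    {θ₀K : HeckeCharacter K} (hθ₀K : IsHeckeCharOf ι' θ₀ θ₀K) (hv0 : θ₀K.IsUnramifiedAt v) (hvbar0 : θ₀K.IsUnramifiedAt vbar)
    {Cbar : Finset (HeightOneSpectrum (𝓞 K))} (hCbar : ∀ u ∈ Cbar, ¬ θ₀K.IsUnramifiedAt u)
    {ΩK' : ℂ} {Ωp' : (unrIntegers 3)ˣ} {Lφ : UnrSeries 3} (hΩK' : ΩK' ≠ 0)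
    (hLφ : IsKatzLFunction ι' v vbar Cbar κ γ θ₀K ΩK' ((Ωp' : unrIntegers 3) : ℂ_[3]) Lφ)
    {e : ℂ} {ΩK : ℂ} {Ωp : (unrIntegers 3)ˣ} {L : UnrSeries 3} (he : e = 1 ∨ e = -1) (hΩK : ΩK ≠ 0)
    (hL : IsBranchBDPLFunction ι' v κ γ f' (KellerYin2024.genusHeckeCharacter K 3) e ΩK ((Ωp : unrIntegers 3) : ℂ_[3]) L)
    (j : ℤ_[3] →+* unrIntegers 3)
    (hj : ∀ x : ℤ_[3], ((j x : unrIntegers 3) : ℂ_[3]) = algebraMap ℚ_[3] ℂ_[3] (x : ℚ_[3])) :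
    (XAc.charIdeal (W.baseChange K) 3 κ vbar (∅ : Set (HeightOneSpectrum (𝓞 K))) γ).map (PowerSeries.map j) =
        Ideal.span {L} ∧
      ∃ n : ℕ, FirstUnitCoeffAt L n ∧
        n = lambdaInvariant 3 (XAc (W.baseChange K) 3 κ vbar (∅ : Set (HeightOneSpectrum (𝓞 K))) γ) := by
  obtain ⟨n, hLn, hle⟩ := exists_firstUnitCoeffAt_le_lambdaInvariant_three hAN hBR hprop125 hge hfact hlift hlocal hPT ι' W K v vbar κ γ hf hS hX hSG hna hv3 hf' hN' htw hpair hθ₀ hθ₀K hv0 hvbar0 hCbar hΩK' hLφ he hΩK hL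
  -- `𝔛` torsion with `μ = 0` (CGLS Prop. 14, generation 25)
  obtain ⟨hT, hμ⟩ := isTorsion_muInvariant_eq_zero_empty_of_prop14_of_subGordTwo_of_forall_twist hfact W K vbar κ γ
    (by norm_num) hX hSG hna hS.imagQuad (by rw [hS.level]; exact hS.heegner) hS.split hS.mem_vbar hS.anticyclotomic
  have he0 : e ≠ 0 := by rcases he with rfl | rfl <;> norm_num
  have hΩp0 : ((Ωp : unrIntegers 3) : ℂ_[3]) ≠ 0 := by
    rw [Ne, ZeroMemClass.coe_eq_zero]; exact Ωp.ne_zero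
  obtain ⟨k, hk⟩ := hDVD ι' W K v vbar κ γ hf hS hf' hN' htw e ΩK _ L he0 hΩK hΩp0 hL j hj
  haveI : Module.Finite (IwasawaAlgebra 3) (XAc (W.baseChange K) 3 κ vbar (∅ : Set (HeightOneSpectrum (𝓞 K))) γ) :=
    XAc.module_finite_empty _ 3 κ vbar γ
  obtain ⟨heq, hn⟩ := charIdeal_map_eq_span_of_C_pow_mul_mem_of_firstUnitCoeff_le _ hT hμ j hj hLn hle hk
  exact ⟨heq, n, hLn, hn⟩

/-- **The door direction H3 at the frame** (`Ch_Λ(X_ac^∅(W_K))·R₀⟦T⟧ ⊆ (L)`) at `p = 3` for a non-anomalous twist, Greenberg-free.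
[claim: KellerYin2024PotOrd, status: under-review] [cite: KellerYin2024b, Thm. 3.5.1 (arXiv:2410.23241 p. 20) (preprint; the door direction of its conclusion)] -/
theorem xac_charIdeal_map_le_span_three_of_dvd
    (hAN : thm351_anacong_branch_three) (hBR : thm122_charLambda_pair_three)
    (hprop125 : prop125_characterGrSelmerDual_torsion_muZero_dim) (hge : prop125_characterGrSelmerDual_corank_ge) (hfact : prop14_residualCharacterSelmer_finite)
    (hlift : cor126_residualCharacter_globalLift) (hlocal : cor126_residualCharacter_localSurjective)
    (hPT : ∀ (L : Type) [Field L] [NumberField L] [IsTotallyComplex L] (S : Set (HeightOneSpectrum (𝓞 L))),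
      S.Finite → Literature.NumberTheory.GaloisCohomology.poitouTate_shaRestricted_tateDual_natural_at L S)
    (hDVD : thm336_dvd_branch_OPEN)
    (ι' : PadicAlgCl 3 ≃+* ℂ) (W : WeierstrassCurve ℚ) [W.IsElliptic] [W.IsGloballyMinimal]
    (K : Type) [Field K] [NumberField K] [IsGalois ℚ K]
    (v vbar : HeightOneSpectrum (𝓞 K)) (κ : ZpExtension K 3) (γ : absoluteGaloisGroup K)
    [hγ : Fact (κ.IsTopGenerator γ)] {N : ℕ} [NeZero N] {f : CuspForm (CongruenceSubgroup.Gamma0 N) 2}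
    (hf : IsNewformOf W f) (hS : PotOrdSetting ι' W K v vbar κ N)
    (hX : ClassX3 W 3) (hSG : SubGordTwo W 3)
    (hna : ∀ (V : WeierstrassCurve ℚ) [V.IsElliptic] [V.IsGloballyMinimal] (C : VariableChange ℚ),
      GoodOrd V 3 → C • V.quadraticTwist ((-1 : ℚ) ^ (3 / 2) * (3 : ℕ)) = W → ¬ (3 : ℤ) ∣ V.frobeniusTrace 3 - 1)
    (hv3 : ((3 : ℕ) : 𝓞 K) ∈ v.asIdeal)
    {N' : ℕ} [NeZero N'] {f' : CuspForm (CongruenceSubgroup.Gamma0 N') 2} (hf' : IsNewform0 f') (hN' : ¬ 3 ∣ N')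
    (htw : ∃ S : Finset ℕ, ∀ ℓ : ℕ, ℓ.Prime → ℓ ∉ S →
      cuspCoeff f ℓ = ((legendreSym 3 ℓ : ℤ) : ℂ) * cuspCoeff f' ℓ)
    {θsub θquot : FramedGaloisRep K (padicCoeffIntegers (∅ : Set (PadicAlgCl 3))) 1}
    (hpair : IsResidualPairOver (W.baseChange K) 3 θsub θquot)
    {θ₀ : FramedGaloisRep K (padicCoeffIntegers (∅ : Set (PadicAlgCl 3))) 1} (hθ₀ : θ₀ = θsub ∨ θ₀ = θquot)
    {θ₀K : HeckeCharacter K} (hθ₀K : IsHeckeCharOf ι' θ₀ θ₀K) (hv0 : θ₀K.IsUnramifiedAt v) (hvbar0 : θ₀K.IsUnramifiedAt vbar)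
    {Cbar : Finset (HeightOneSpectrum (𝓞 K))} (hCbar : ∀ u ∈ Cbar, ¬ θ₀K.IsUnramifiedAt u)
    {ΩK' : ℂ} {Ωp' : (unrIntegers 3)ˣ} {Lφ : UnrSeries 3} (hΩK' : ΩK' ≠ 0)
    (hLφ : IsKatzLFunction ι' v vbar Cbar κ γ θ₀K ΩK' ((Ωp' : unrIntegers 3) : ℂ_[3]) Lφ)
    {e : ℂ} {ΩK : ℂ} {Ωp : (unrIntegers 3)ˣ} {L : UnrSeries 3} (he : e = 1 ∨ e = -1) (hΩK : ΩK ≠ 0)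
    (hL : IsBranchBDPLFunction ι' v κ γ f' (KellerYin2024.genusHeckeCharacter K 3) e ΩK ((Ωp : unrIntegers 3) : ℂ_[3]) L)
    (j : ℤ_[3] →+* unrIntegers 3)
    (hj : ∀ x : ℤ_[3], ((j x : unrIntegers 3) : ℂ_[3]) = algebraMap ℚ_[3] ℂ_[3] (x : ℚ_[3])) :
    (XAc.charIdeal (W.baseChange K) 3 κ vbar (∅ : Set (HeightOneSpectrum (𝓞 K))) γ).map (PowerSeries.map j) ≤
      Ideal.span {L} :=
  (xac_charIdeal_map_eq_span_three_of_dvd hAN hBR hprop125 hge hfact hlift hlocal hPT hDVD ι' W K v vbar κ γ hf hS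
    hX hSG hna hv3 hf' hN' htw hpair hθ₀ hθ₀K hv0 hvbar0 hCbar hΩK' hLφ he hΩK hL j hj).1.le

end Three

end Summit.BirchSwinnertonDyer.BirchSwinnertonDyer.Theorems.SchneiderFreeAdditiveX3.KYBranchThreeOfCGLS

end
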